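import Literature.Geometry.Lorentzian.KerrStabilityLayer
import HarnessLib

/-!
# gr.S05, layer form — ERRATUM EDITION: Klainerman–Szeftel from an admissible initial data layer,
# with convergence to Kerr along CONE-ADAPTED leaves

Erratum edition (rename-and-redirect, D-0014) of the named fact
`Literature.Geometry.Lorentzian.klainerman_szeftel_kerr_stability_small_a_layer`
(`KerrStabilityLayer.lean`, proposal p773241; corollaries `.of_le`, `.of_coneDist_lt`). The corrected
fact is `klainerman_szeftel_kerr_stability_small_a_layer_cones` below; the old declaration keeps its
name and statement (append-only) and carries an erratum paragraph in its docstring pointing here.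
Origin: finding F-g15-1 «D2 seam» of the decomposition cell `decomp-fsc` (lens 5, g15), endorsed by
the cell critic (row 153) and second-read on the corrected text (2026-08-30); text drafted by the cell's
writer seat (`ERRATUM-KerrStabilityLayer-v1`), locators re-verified against the arXiv v1 PDF by the
filing literature-prover. An erratum corrects a citation; it proves nothing about the Final State
Conjecture.

## What is misstated in the old fact

Its conclusion is the conjunction
`𝒟oc ⊆ J⁺(range c.toFun) ∧ c.HasCompleteFutureNullInfinityFar ∧ 𝒟.toSpacetime.ConvergesToKerr 𝒟oc M' a' k'`.
`Spacetime.ConvergesToKerr 𝒟oc M' a' k'` (`KerrConvergence.lean`: `ConvergesTo`, `IsLateEmbedding`,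
`Kerr.background`) asks for a late embedding `Ψ` of the Kerr reference background `Kerr.background M' a'`
— domain the Kerr–Schild exterior `{r > max r₊ 0}`, time function `t* = x⁰` — with
`Ψ '' {t* > τ₀} ⊆ 𝒟oc` and the `Cᵏ'` deviation, SUP OVER THE FULL SLABS `{t* = τ}`, tending to `0`.
The slabs `{t* = τ} ∩ {r > r₊}` are asymptotically flat and reach spacelike infinity `i⁰`, whereas the
layer's leaves are asymptotic to OUTGOING NULL CONES (`KerrAdapted.layerTime`, `KerrAdapted.layer` of
`KerrAdaptedLayerNorm.lean`), so that `J⁺(range c) ⊆ {u ≥ u₀(M, a, τ, ℓ)}` misses the far end of every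
slab. Hence already for EXACT Kerr data (all hypotheses met, layer norm `0`) the canonical identity
witness violates `Ψ '' lateRegion τ₀ ⊆ 𝒟oc ⊆ J⁺(range c)` for every `τ₀`; only asymptotically boosted
slab families could witness the pair, and none is known («unsatisfiable-or-junk-witnessed»). The
source proves nothing on the far ends of asymptotically flat slabs: its spacetime
`𝓜_∞ = ⁽ᵉˣᵗ⁾𝓜_∞ ∪ ⁽ⁱⁿᵗ⁾𝓜_∞` has past boundary `𝓑₁ ∪ 𝓑̲₁` INSIDE the initial data layer `𝓛₀` (§3.2.1)
and is foliated by the outgoing optical function `u` (on `⁽ᵉˣᵗ⁾𝓜`) and the ingoing function `u̲` (on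
`⁽ⁱⁿᵗ⁾𝓜`); far ends of asymptotically flat hypersurfaces are delegated to Klainerman–Nicolò /
Caciotta–Nicolò (Remark 3.4.3), i.e. to a different theorem.

## What the source prints (Klainerman–Szeftel, arXiv:2104.11857v1 — the only arXiv version, 801 pp.;
## journal version PAMQ 19 (2023) 791–1678; section / theorem numbers and page numbers below are those
## PRINTED in the arXiv v1 PDF)

* §3.1 *Initial data layer* (p. 113): a region `𝓛₀ = ⁽ᵉˣᵗ⁾𝓛₀ ∪ ⁽ⁱⁿᵗ⁾𝓛₀` on which `g` is close to
  `Kerr(a₀, m₀)`; §3.3.6 *Initial layer norm* `ℑ_k` (p. 133).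
* §3.2.1 *Boundaries* of a GCM admissible spacetime (p. 119): `∂⁻𝓜 = 𝓑₁ ∪ 𝓑̲₁`, "The past boundary
  `𝓑₁ ∪ 𝓑̲₁` is included in the initial data layer `𝓛₀`".
* §3.4.1 *Smallness constants* (pp. 134–136): `m₀ > 0`, `|a₀| < m₀`, `k_large`, `ε₀`, …; (3.4.6)
  `k_small = ⌊k_large/2⌋ + 1` (p. 135); note after (3.4.3)–(3.4.5) (p. 135): one may set `a₀ = 0` when
  `0 < |a₀| ≲ ε₀`.
* §3.4.2 (pp. 136–137): Def. 3.4.2 — `𝓛₀(a₀, m₀)` is *admissible* if it lies in the future of an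
  asymptotically flat initial data set on a spacelike `Σ₀` of ADM mass `m₀` and angular momentum `a₀`;
  `(ε₀, k)`-admissible if moreover `ℑ_k ≤ ε₀²`. Remark 3.4.3: [36] Klainerman–Nicolò, [37], [8]
  Caciotta–Nicolò produce such layers from Cauchy data. Def. 3.4.4: a future development of `𝓛₀` is a
  future development of the data set on `Σ₀`. Def. 3.4.5: *admissible future null complete* spacetime
  `𝓜 = ⁽ᵉˣᵗ⁾𝓜 ∪ ⁽ⁱⁿᵗ⁾𝓜` — a future development of an admissible layer, "the future null infinity `𝓘⁺` of
  `𝓜` is complete", the other future boundary `𝓐` spacelike and in the complement of `J⁻(𝓘⁺)`, `⁽ᵉˣᵗ⁾𝓜`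
  with an outgoing PG structure and a function `u`, `e₄(u) = 0`. Def. 3.4.6 (p. 137): the norms
  `𝔑^{(Sup)}_{k_large}(a_∞, m_∞)`, `𝔑^{(Dec)}_{k_small}(a_∞, m_∞)`.
* §3.4.3 *Statement of the main theorem* (p. 137); **Main Theorem (version 2)** (p. 138): *Let
  `𝓛₀ = 𝓛₀(a₀, m₀)` be an `(ε₀, k_large + 10)`-admissible initial data layer as in Def. 3.4.2, with
  `|a₀|/m₀` sufficiently small, `k_large` sufficiently large and `ε₀ > 0` sufficiently small; in particular
  (3.4.7) `ℑ_{k_large+10} ≤ ε₀²`. Then `𝓛₀` possesses an admissible future complete development `𝓜_∞`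
  as in Def. 3.4.5. Moreover (1) there are constants `(a_∞, m_∞)`, `|a_∞| ≪ m_∞`, with (3.4.8)
  `𝔑^{(Sup)}_{k_large} + 𝔑^{(Dec)}_{k_small} + |a_∞ − a₀| + |m_∞ − m₀| ≤ C ε₀`, `C` universal,
  `k_small = ⌊k_large/2⌋ + 1`; (2) `𝓜_∞` is a limit of finite GCM admissible spacetimes.*
* Consequences of (3.4.8) (pp. 138–139): pointwise decay of all linearised Ricci / curvature
  components, on `⁽ᵉˣᵗ⁾𝓜_∞` in powers of `r` and `u`, on `⁽ⁱⁿᵗ⁾𝓜_∞` as `ε₀ u̲^{−1−δ_dec}`; "analog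
  statements of the above estimates also hold for `𝔡^k` derivatives with `k ≤ k_small`" (p. 139).
  Further statements 1–2 (pp. 139–140: Bondi mass, final angular momentum) and 3–4 (p. 140): `⁽ᵉˣᵗ⁾𝓜`
  (resp. `⁽ⁱⁿᵗ⁾𝓜`) is covered by three regular coordinate patches `(u, r, θ, φ)`, `(u, r, x¹, x²)` (resp.
  with `u̲`) in which `g = g_{a_∞,m_∞} + (du, dr, r dθ, r sin θ dφ)² O(ε₀ u^{−1−δ_dec})` (resp.
  `O(ε₀ u̲^{−1−δ_dec})`), `g_{a_∞,m_∞}` the Kerr metric in the corresponding Kerr coordinates (also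
  §3.8.4, pp. 167–168, from Prop. 4.1.1–4.1.2). Remark 3.4.8 (p. 141): (3.4.7) may be weakened.
* §1.7.4 *Conclusions* (pp. 42–43): `𝓘⁺` of `𝓜_∞` is complete; the other future boundary `𝓐` lies in
  the complement of `J⁻(𝓘⁺)`, whence the event horizon (also §3.8.1, p. 154).
* Thm. 1.2.1 (Main Theorem, first version; §1.2.1, p. 22): complete `𝓘⁺`, convergence in the causal
  past of `𝓘⁺` to a nearby Kerr, final parameters close to the initial ones.

So the printed convergence `g → g_{a_∞, m_∞}` is UNIFORM ON THE LEAVES `{u = const}` of `⁽ᵉˣᵗ⁾𝓜_∞`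
(outgoing null cones, terminating at `𝓘⁺`) continued by the leaves `{u̲ = const}` of `⁽ⁱⁿᵗ⁾𝓜_∞`, as
`u, u̲ → ∞`, inside `J⁺(𝓛₀)` — not on asymptotically flat slabs. (Locator note: the tree's held text
`paper:arxiv-2104.11857` is the chunked TeX source, whose extracted numbering drops the chapter prefix
— its "Definition 4.2", "Remark 4.3" are Def. 3.4.2, Remark 3.4.3 as printed — and whose chunk indices
are not page numbers.)

## The corrected rendering (this file; namespace `Literature.Geometry.Lorentzian`)

* `KerrAdapted.restLateBackground M a τ ℓ` — the **cone-adapted late background of `Kerr(M, a)`**: the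
  reference background (`ModelBackground`, `KerrConvergence.lean`) with the SAME domain and form as
  `Kerr.background M a` (Kerr–Schild exterior `{r > max r₊ 0}`, form `Kerr.bilin M a`, radius `Kerr.radius a`)
  but time function the ONE-HOLE KERR-ADAPTED LAYER TIME `s = x⁰ − τ − H_ℓ(x̲)` of
  `KerrAdaptedLayerNorm.lean` (`KerrAdapted.layerTime` with `N = 1`, `Λ = 1`, `ξ = 0`; exactly the time
  function of the one-hole layer background `KerrAdapted.restBackground M a τ ℓ` of `ConeDistance.lean`,
  `restLateBackground_time … = rfl`), whose level sets are the tortoise-corrected hyperboloids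
  `H ∼ r + 4M log r` asymptotic to the outgoing null cones and terminating at `𝓘⁺`
  (Dafermos–Rodnianski arXiv:0811.0354 §4, `Σ̃_τ`; Moschidis arXiv:1509.08489 §3.1, Def. 3.2). Its late
  regions `{s > σ₀} ∩ {r > r₊}` lie inside `{u ≥ u₁(σ₀)}`, hence — for `σ₀` large — inside the causal
  future of any admissible layer of the same hole, and its «slabs» are leaves ending at `𝓘⁺`.
* `Spacetime.ConvergesToKerrAlongCones 𝓢 𝒟 M a τ ℓ k := 𝓢.ConvergesTo (restLateBackground M a τ ℓ) 𝒟 k` —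
  `Cᵏ` convergence to `g_{M,a}` with the deviation measured leaf by leaf on the cone-adapted leaves: the
  tree's reading of statements 3–4 after (3.4.8). (The Kerr–Schild Cartesian components and flat
  derivatives of the deviation are bounded by the printed frame components and `𝔡^{≤k}` derivatives on
  `r ≥ r₊(1 − δ_𝓗)`, with constants depending on `(M, a)`; on a leaf `{s = σ}` one has `u ≥ σ − C` on
  its part in `⁽ᵉˣᵗ⁾𝓜` and `u̲ ≥ σ − C` on its part in `⁽ⁱⁿᵗ⁾𝓜`, so the printed `O(ε₀ u^{−1−δ_dec})`,
  `O(ε₀ u̲^{−1−δ_dec})` give leaf-sup → `0` as `σ → ∞`.)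
* `klainerman_szeftel_kerr_stability_small_a_layer_cones` — **the corrected named fact**: verbatim the
  old statement EXCEPT (i) the last conjunct is `ConvergesToKerrAlongCones 𝒟oc M' a' τ (θM) k'`
  (cone-adapted leaves of the FINAL `Kerr(M', a')`, base time and scale those of the hypothesis layer)
  instead of `ConvergesToKerr 𝒟oc M' a' k'` (asymptotically flat slabs), which makes the kept region
  conjunct `𝒟oc ⊆ J⁺(range c.toFun)` («`𝓜_∞` lies in the future of `𝓛₀ ⊇ 𝓑₁ ∪ 𝓑̲₁`», §3.2.1) consistent
  and satisfied by the identity witness on exact Kerr data (for `σ₀ ≥ θM` every past-inextendible causal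
  curve from a point of `{s > σ₀} ∩ {r > r₊}` has `t* → −∞`, hence crosses the middle leaf
  `{s = θM/2} ∩ {r > M}` of the layer — the adapted layer `{0 < s < ℓ} ∩ {(r₊ + r₋)/2 < r}` reaches
  across the horizon, so the crossing is charted; deviation `≡ 0`); (ii) the convergence order is
  quantified `∀ k'` OUTERMOST (printed: "`k_large` sufficiently large" is a free hypothesis and
  `k_small = ⌊k_large/2⌋ + 1` derivatives decay, (3.4.6), (3.4.8), p. 139), all smallness constants being
  allowed to depend on `k'` — specialising `k'` recovers the old quantifier prefix `∃ k p δ k' θ a₀ …`.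
  Paraphrase notes (1)–(4) of `KerrStabilityLayer.lean` stand unchanged (reference parameters; the
  `∀ η ∃ ε` modulus of Thm. 1.2.1; existential exponents and the tree's layer geometry; `𝒟oc`
  existential — the fact asserts that a settled late exterior region exists in the future of the layer,
  with complete `𝓘⁺` seen from the layer, NOT that the whole `D⁺(layer) ∩ J⁻(𝓘⁺)` settles; no horizon
  location, no rates, nothing about `𝓐`). Domain caveat: the late background's domain `{r > max r₊ 0}`
  of the final Kerr claims LESS than print (`⁽ⁱⁿᵗ⁾𝓜` reaches `r = r₊(1 − δ_𝓗)`), as the accepted Cauchy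
  rendering `klainerman_szeftel_kerr_stability_small_a_cauchy` (`StabilityCauchy.lean`) already does.
* `…_cones.of_le`, `…_cones.of_coneDist_lt`, `…_cones.mono_order` — the two corollaries of the old
  file, re-derived verbatim for the corrected fact (tolerance monotonicity; the cone-distance form
  consumed by the decomposition cell's piece «Tail»), and monotonicity in the convergence order.

NOT ADDED (left to a porting lane if ever wanted): the interior region `⁽ⁱⁿᵗ⁾𝓜` beyond `r > r₊` and
the event-horizon location, decay RATES, the conversion to asymptotically flat slabs (a separate
Klainerman–Nicolò-backed statement).

Consumers of the old declaration in the tree on 2026-08-30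
(`rg klainerman_szeftel_kerr_stability_small_a_layer lean/`): ONLY its own file (the two corollaries) —
no `Summits/**` or other `Literature/**` module names it; nothing to re-point or reopen (count: 0
external consumers, 2 internal corollaries re-derived here).

## References

* S. Klainerman, J. Szeftel, *Kerr stability for small angular momentum*, arXiv:2104.11857v1 (2021,
  801 pp.) = Pure Appl. Math. Q. 19 (2023) 791–1678: Thm. 1.2.1 (p. 22), §1.7.4 (pp. 42–43), §3.1
  (p. 113), §3.2.1 (p. 119), §3.3.6 (p. 133), §3.4.1 with (3.4.6) (pp. 134–136), §3.4.2: Def.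
  3.4.2–3.4.6 and Remark 3.4.3 (pp. 136–137), §3.4.3: Main Theorem (version 2) with (3.4.7)–(3.4.8),
  its consequences and statements 1–4 (pp. 137–140), Remark 3.4.8 (p. 141), §3.8.1 (p. 154), §3.8.4
  (pp. 167–168); arXiv v1 page numbers. Bib key `KlainermanSzeftel2023`.
* E. Giorgi, S. Klainerman, J. Szeftel, arXiv:2205.14808; D. Shen, arXiv:2205.12336 (inputs of the proof).
* M. Dafermos, I. Rodnianski, *Lectures on black holes and linear waves*, arXiv:0811.0354, §4
  (hyperboloidal leaves `Σ̃_τ` terminating at `𝓘⁺`) and §2.6.2 (Christodoulou's complete `𝓘⁺`). Bib key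
  `DafermosRodnianski2008`.
* G. Moschidis, Ann. PDE 2 (2016) = arXiv:1509.08489, §3.1 Def. 3.2 (a hypersurface terminates at `𝓘⁺`
  iff `u` is bounded on its far part). Bib key `Moschidis2016`.
* M. Dafermos, G. Holzegel, I. Rodnianski, M. Taylor, arXiv:2104.08222, §1 (late-time charts). Bib key
  `DafermosHolzegelRodnianskiTaylor2021`.
-/

noncomputable section

open Set TopologicalSpace Filter
open scoped Manifold ContDiff Topology ENNReal

universe u

namespace Literature.Geometry.Lorentzian

/-! ### The cone-adapted late background of one Kerr hole -/

namespace KerrAdapted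

/-- The **cone-adapted late background of `Kerr(M, a)`** (one hole at rest at the origin of its
Kerr–Schild chart): domain the Kerr–Schild exterior `Kerr.exterior M a = {r > max r₊ 0}`, reference form
`Kerr.bilin M a`, radius `Kerr.radius a` — all as in `Kerr.background M a` — and TIME FUNCTION the one-hole
Kerr-adapted layer time `s = x⁰ − τ − H_ℓ(x̲)` (`KerrAdapted.layerTime` with `N = 1`, `Λ = 1`, `ξ = 0`,
base lab time `τ`, scale `ℓ`), whose level sets are asymptotic to the outgoing null cones and terminate at
`𝓘⁺`. Its time slabs are the leaves `{s = σ} ∩ {r > r₊}`, the tree's stand-in for the leaves `{u = σ}` of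
`⁽ᵉˣᵗ⁾𝓜_∞` continued by `{u̲ = σ}` of `⁽ⁱⁿᵗ⁾𝓜_∞` in Klainerman–Szeftel, arXiv:2104.11857v1, Def. 3.4.5
(pp. 136–137) and Main Theorem (version 2), statements 3–4 (p. 140); leaf template Dafermos–Rodnianski
arXiv:0811.0354 §4 (`Σ̃_τ`), Moschidis arXiv:1509.08489 §3.1 Def. 3.2.
[cite: KlainermanSzeftel2023, Def. 3.4.5 (pp. 136–137) and Main Theorem (version 2) statements 3–4 (p. 140), arXiv v1] -/
def restLateBackground (M a τ ℓ : ℝ) : ModelBackground where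
  domain := Kerr.exterior M a
  bilin := Kerr.bilin M a
  time := layerTime (fun _ : Fin 1 ↦ M) (fun _ ↦ a) (fun _ ↦ (1 : lorentzGroup)) (fun _ ↦ (0 : E3)) τ ℓ
  radius := Kerr.radius a

/-- The domain of the cone-adapted late background is the Kerr–Schild exterior (by `rfl`).
[cite: KlainermanSzeftel2023, Def. 3.4.5 (arXiv v1 pp. 136–137)] -/
@[simp]
theorem restLateBackground_domain (M a τ ℓ : ℝ) :
    (restLateBackground M a τ ℓ).domain = Kerr.exterior M a :=
  rfl

/-- The reference form of the cone-adapted late background is that of `Kerr.background M a` (by `rfl`):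
only the time function differs.
[cite: KlainermanSzeftel2023, Main Theorem (version 2) statements 3–4 (arXiv v1 p. 140)] -/
theorem restLateBackground_bilin (M a τ ℓ : ℝ) :
    (restLateBackground M a τ ℓ).bilin = (Kerr.background M a).bilin :=
  rfl

/-- The time function of the cone-adapted late background is the one-hole adapted layer time, i.e. the
time function of the one-hole layer background `KerrAdapted.restBackground M a τ ℓ` of `ConeDistance.lean`
(by `rfl`). [cite: KlainermanSzeftel2023, §3.1 (p. 113) and Def. 3.4.5 (pp. 136–137), arXiv v1] -/
theorem restLateBackground_time (M a τ ℓ : ℝ) :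
    (restLateBackground M a τ ℓ).time = (restBackground M a τ ℓ).time :=
  rfl

/-- The time slabs of the cone-adapted late background are the leaves `{x ∈ {r > r₊} | s(x) = σ}` of the
adapted layer time (terminating at `𝓘⁺`; Moschidis arXiv:1509.08489, Def. 3.2).
[cite: Moschidis2016, §3.1 Def. 3.2] -/
theorem mem_timeSlab_restLateBackground {M a τ ℓ σ : ℝ} {x : (restLateBackground M a τ ℓ).domain} :
    x ∈ (restLateBackground M a τ ℓ).timeSlab σ ↔
      layerTime (fun _ : Fin 1 ↦ M) (fun _ ↦ a) (fun _ ↦ (1 : lorentzGroup)) (fun _ ↦ (0 : E3)) τ ℓ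
        x.1 = σ :=
  Iff.rfl

end KerrAdapted

/-! ### Convergence to Kerr along cone-adapted leaves -/

namespace Spacetime

variable (𝓢 : Spacetime.{u} 4)

/-- **Convergence to `g_{M,a}` in the region `𝒟`, in `Cᵏ`, ALONG CONE-ADAPTED LEAVES**: `ConvergesTo`
(`KerrConvergence.lean`: a late embedding `Ψ` of `{s > σ₀} ∩ {r > r₊}` into `𝒟` covering its late part,
with the `Cᵏ` sup of the deviation `Ψ^* g − g_{M,a}` over the leaf `{s = σ}` tending to `0` as `σ → ∞`)
for the cone-adapted late background `KerrAdapted.restLateBackground M a τ ℓ`. This is the tree's reading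
of Klainerman–Szeftel's conclusion `g = g_{a_∞,m_∞} + O(ε₀ u^{−1−δ_dec})` on `⁽ᵉˣᵗ⁾𝓜_∞`,
`+ O(ε₀ u̲^{−1−δ_dec})` on `⁽ⁱⁿᵗ⁾𝓜_∞`, with `𝔡^{≤ k_small}` derivatives (arXiv:2104.11857v1, Main Theorem
(version 2), §3.4.3: the decay consequences of (3.4.8), pp. 138–139, and statements 3–4, p. 140), as
opposed to `ConvergesToKerr` (same background form, asymptotically flat slabs `{t* = τ}`, the currency of
the Cauchy-data theorems).
[cite: KlainermanSzeftel2023, Main Theorem (version 2) §3.4.3, consequences of (3.4.8) and statements 3–4 (arXiv v1 pp. 138–140)] -/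
def ConvergesToKerrAlongCones (𝒟 : Set 𝓢.carrier) (M a τ ℓ : ℝ) (k : ℕ) : Prop :=
  𝓢.ConvergesTo (KerrAdapted.restLateBackground M a τ ℓ) 𝒟 k

variable {𝓢}

/-- Convergence along cone-adapted leaves in `Cᵏ'` implies it in `Cᵏ` for `k ≤ k'`
(Klainerman–Szeftel, arXiv:2104.11857v1, Main Theorem (version 2): `𝔡^k` derivatives for all `k ≤ k_small`,
p. 139). [cite: KlainermanSzeftel2023, Main Theorem (version 2) §3.4.3 (arXiv v1 pp. 138–139)] -/
theorem ConvergesToKerrAlongCones.of_le {𝒟 : Set 𝓢.carrier} {M a τ ℓ : ℝ} {k k' : ℕ}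
    (h : 𝓢.ConvergesToKerrAlongCones 𝒟 M a τ ℓ k') (hk : k ≤ k') :
    𝓢.ConvergesToKerrAlongCones 𝒟 M a τ ℓ k :=
  ConvergesTo.of_le h hk

end Spacetime

/-! ### gr.S05, layer form, CORRECTED: the named fact -/

/-- **Nonlinear stability of slowly rotating Kerr from an admissible initial data layer — erratum edition**
(Klainerman–Szeftel, Main Theorem, version 2; named fact, D-0014; supersedes
`klainerman_szeftel_kerr_stability_small_a_layer`, whose last two conjuncts couple a region in the future of
the layer with convergence on asymptotically flat slabs — see the module docstring). **Source, as printed**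
(arXiv:2104.11857v1, §3.4.2–§3.4.3, pp. 136–140 = PAMQ 19 (2023) 791–1678): *Let `𝓛₀ = 𝓛₀(a₀, m₀)` be
an `(ε₀, k_large + 10)`-admissible initial data layer (Def. 3.4.2: in the future of an asymptotically flat
data set on a spacelike `Σ₀` of ADM parameters `(m₀, a₀)`, with (3.4.7) `ℑ_{k_large+10} ≤ ε₀²`), with
`|a₀|/m₀` sufficiently small, `k_large` sufficiently large and `ε₀ > 0` sufficiently small. Then `𝓛₀`
possesses an admissible future complete development `𝓜_∞ = ⁽ᵉˣᵗ⁾𝓜_∞ ∪ ⁽ⁱⁿᵗ⁾𝓜_∞` (Def. 3.4.5: `𝓘⁺`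
complete; past boundary `𝓑₁ ∪ 𝓑̲₁ ⊂ 𝓛₀`, §3.2.1), and there are constants `(a_∞, m_∞)`, `|a_∞| ≪ m_∞`,
with (3.4.8) `𝔑^{(Sup)}_{k_large} + 𝔑^{(Dec)}_{k_small} + |a_∞ − a₀| + |m_∞ − m₀| ≤ C ε₀`,
`k_small = ⌊k_large/2⌋ + 1` ((3.4.6)); in particular `⁽ᵉˣᵗ⁾𝓜_∞`, `⁽ⁱⁿᵗ⁾𝓜_∞` are covered by regular
coordinate patches `(u, r, ·, ·)`, `(u̲, r, ·, ·)` in which `g = g_{a_∞,m_∞} + O(ε₀ u^{−1−δ_dec})`, resp.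
`O(ε₀ u̲^{−1−δ_dec})`, with `𝔡^{≤ k_small}` derivatives (statements 3–4, p. 140, and the consequences of
(3.4.8), pp. 138–139); Thm. 1.2.1 (p. 22): the final parameters are close to the initial ones.*
**Rendering.** For every convergence order `k'` there are layer exponents `(k, p, δ)`, a scale `θ > 0`
and `a₀ > 0` such that for all `M > 0`, `|a| < a₀ M` and every tolerance `η > 0` there is `ε > 0` with:
for all vacuum data `D` on a connected `3`-manifold, every maximal vacuum Cauchy development `𝒟` of `D`,
every base time `τ` and every admissible Kerr-adapted layer `c` of `Kerr(M, a)` of scale `θM` in `𝒟`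
(`CauchyDevelopment.KerrLayerChart`) with `c.layerNorm k p δ ≤ ε`, there are subextremal `(M', a')` with
`|M' − M| + |a' − a| ≤ η` and a region `𝒟oc ⊆ J⁺(range Φ)` such that `c` sees a complete `𝓘⁺`
(`KerrLayerChart.HasCompleteFutureNullInfinityFar`) and `𝒟` converges to `g_{M',a'}` in `Cᵏ'` on `𝒟oc`
ALONG THE CONE-ADAPTED LEAVES of the final `Kerr(M', a')`, base time `τ`, scale `θM`
(`Spacetime.ConvergesToKerrAlongCones`). Paraphrase notes (1)–(4) of `KerrStabilityLayer.lean` apply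
verbatim; in addition (5) `∀ k'` outermost renders "`k_large` sufficiently large" with every smallness
constant allowed to depend on `k'`. Inputs of the printed proof: Giorgi–Klainerman–Szeftel
arXiv:2205.14808, Shen arXiv:2205.12336.
[cite: KlainermanSzeftel2023, Main Theorem (version 2) §3.4.3 (3.4.7)–(3.4.8) with statements 3–4 (arXiv v1 pp. 137–140), Def. 3.4.2–3.4.5 (pp. 136–137), (3.4.6) (p. 135), §3.2.1 (p. 119) and Thm. 1.2.1 (p. 22)] -/
def klainerman_szeftel_kerr_stability_small_a_layer_cones : Prop :=
  ∀ k' : ℕ, ∃ (k : ℕ) (p δ : ℝ), ∃ θ > (0 : ℝ), ∃ a₀ > (0 : ℝ),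
    ∀ (M a : ℝ), 0 < M → |a| < a₀ * M → ∀ η > (0 : ℝ), ∃ ε > (0 : ℝ),
      ∀ (X : Type) [TopologicalSpace X] [ChartedSpace E3 X] [IsManifold (𝓡 3) ∞ X]
        [ConnectedSpace X] (D : InitialDataSet (𝓡 3) X) [D.metric.HasLeviCivita],
        D.IsVacuumConstraintSolution →
        ∀ 𝒟 : VacuumCauchyDevelopment D, 𝒟.IsMaximal →
          ∀ (τ : ℝ) (c : 𝒟.toCauchyDevelopment.KerrLayerChart M a τ (θ * M)),
            c.layerNorm k p δ ≤ ENNReal.ofReal ε →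
              ∃ (M' a' : ℝ) (𝒟oc : Set 𝒟.carrier), Kerr.IsSubextremal M' a' ∧
                |M' - M| + |a' - a| ≤ η ∧
                𝒟oc ⊆ 𝒟.metric.causalFuture 𝒟.timeOrientation (range c.toFun) ∧
                c.HasCompleteFutureNullInfinityFar ∧
                𝒟.toSpacetime.ConvergesToKerrAlongCones 𝒟oc M' a' τ (θ * M) k'

/-- **Monotonicity in the tolerance** for the corrected fact: the radius `ε` serving a tolerance `η`
serves every larger tolerance `η' ≥ η` (Klainerman–Szeftel, Thm. 1.2.1: the final parameters are close to
the initial ones). [cite: KlainermanSzeftel2023, Thm. 1.2.1 (arXiv v1 p. 22)] -/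
theorem klainerman_szeftel_kerr_stability_small_a_layer_cones.of_le
    (h : klainerman_szeftel_kerr_stability_small_a_layer_cones) (k' : ℕ) :
    ∃ (k : ℕ) (p δ : ℝ), ∃ θ > (0 : ℝ), ∃ a₀ > (0 : ℝ),
      ∀ (M a : ℝ), 0 < M → |a| < a₀ * M → ∀ η > (0 : ℝ), ∃ ε > (0 : ℝ), ∀ η' : ℝ, η ≤ η' →
        ∀ (X : Type) [TopologicalSpace X] [ChartedSpace E3 X] [IsManifold (𝓡 3) ∞ X]
          [ConnectedSpace X] (D : InitialDataSet (𝓡 3) X) [D.metric.HasLeviCivita],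
        D.IsVacuumConstraintSolution →
          ∀ 𝒟 : VacuumCauchyDevelopment D, 𝒟.IsMaximal →
            ∀ (τ : ℝ) (c : 𝒟.toCauchyDevelopment.KerrLayerChart M a τ (θ * M)),
              c.layerNorm k p δ ≤ ENNReal.ofReal ε →
                ∃ (M' a' : ℝ) (𝒟oc : Set 𝒟.carrier), Kerr.IsSubextremal M' a' ∧
                  |M' - M| + |a' - a| ≤ η' ∧
                  𝒟oc ⊆ 𝒟.metric.causalFuture 𝒟.timeOrientation (range c.toFun) ∧
                  c.HasCompleteFutureNullInfinityFar ∧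
                  𝒟.toSpacetime.ConvergesToKerrAlongCones 𝒟oc M' a' τ (θ * M) k' := by
  obtain ⟨k, p, δ, θ, hθ, a₀, ha₀, H⟩ := h k'
  refine ⟨k, p, δ, θ, hθ, a₀, ha₀, fun M a hM ha η hη ↦ ?_⟩
  obtain ⟨ε, hε, Hε⟩ := H M a hM ha η hη
  refine ⟨ε, hε, fun η' hη' X _ _ _ _ D _ hD 𝒟 h𝒟 τ c hc ↦ ?_⟩
  obtain ⟨M', a', 𝒟oc, hsub, hpar, hJ, hnull, hconv⟩ := Hε X D hD 𝒟 h𝒟 τ c hc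
  exact ⟨M', a', 𝒟oc, hsub, hpar.trans hη', hJ, hnull, hconv⟩

/-- **The smallness hypothesis through the cone distance**, corrected fact: if a region `S` of a maximal
vacuum Cauchy development has cone distance `coneDist 𝒟 M a (θM) k p δ S < ε` to a slowly rotating
`Kerr(M, a)` (`ConeDistance.lean`), then the conclusions hold for a layer INSIDE `S`, the region `𝒟oc`
lying in `J⁺(S)`, with convergence along the cone-adapted leaves of the final Kerr based at that layer's
time. This is the form in which the decomposition cell's piece «Tail» consumes the theorem.
[cite: KlainermanSzeftel2023, Main Theorem (version 2) §3.4.3 (p. 138) and Def. 3.4.2 (p. 136), arXiv v1] -/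
theorem klainerman_szeftel_kerr_stability_small_a_layer_cones.of_coneDist_lt
    (h : klainerman_szeftel_kerr_stability_small_a_layer_cones) (k' : ℕ) :
    ∃ (k : ℕ) (p δ : ℝ), ∃ θ > (0 : ℝ), ∃ a₀ > (0 : ℝ),
      ∀ (M a : ℝ), 0 < M → |a| < a₀ * M → ∀ η > (0 : ℝ), ∃ ε > (0 : ℝ),
        ∀ (X : Type) [TopologicalSpace X] [ChartedSpace E3 X] [IsManifold (𝓡 3) ∞ X]
          [ConnectedSpace X] (D : InitialDataSet (𝓡 3) X) [D.metric.HasLeviCivita],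
        D.IsVacuumConstraintSolution →
          ∀ 𝒟 : VacuumCauchyDevelopment D, 𝒟.IsMaximal → ∀ S : Set 𝒟.carrier,
            𝒟.toCauchyDevelopment.coneDist M a (θ * M) k p δ S < ENNReal.ofReal ε →
              ∃ (τ : ℝ) (c : 𝒟.toCauchyDevelopment.KerrLayerChart M a τ (θ * M)),
                range c.toFun ⊆ S ∧
                ∃ (M' a' : ℝ) (𝒟oc : Set 𝒟.carrier), Kerr.IsSubextremal M' a' ∧
                  |M' - M| + |a' - a| ≤ η ∧
                  𝒟oc ⊆ 𝒟.metric.causalFuture 𝒟.timeOrientation S ∧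
                  c.HasCompleteFutureNullInfinityFar ∧
                  𝒟.toSpacetime.ConvergesToKerrAlongCones 𝒟oc M' a' τ (θ * M) k' := by
  obtain ⟨k, p, δ, θ, hθ, a₀, ha₀, H⟩ := h k'
  refine ⟨k, p, δ, θ, hθ, a₀, ha₀, fun M a hM ha η hη ↦ ?_⟩
  obtain ⟨ε, hε, Hε⟩ := H M a hM ha η hη
  refine ⟨ε, hε, fun X _ _ _ _ D _ hD 𝒟 h𝒟 S hS ↦ ?_⟩
  obtain ⟨τ, c, hcS, hc⟩ :=
    (CauchyDevelopment.coneDist_lt_iff 𝒟.toCauchyDevelopment M a (θ * M) k p δ).1 hS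
  obtain ⟨M', a', 𝒟oc, hsub, hpar, hJ, hnull, hconv⟩ := Hε X D hD 𝒟 h𝒟 τ c hc.le
  exact ⟨τ, c, hcS, M', a', 𝒟oc, hsub, hpar,
    hJ.trans (LorentzianMetric.causalFuture_mono hcS), hnull, hconv⟩

/-- **Lower orders come for free**: under the corrected fact, the data serving order `k'` serve every
order `k'' ≤ k'` with the same constants (Klainerman–Szeftel: `𝔡^k` derivatives for all `k ≤ k_small`,
p. 139). [cite: KlainermanSzeftel2023, Main Theorem (version 2) §3.4.3 (arXiv v1 pp. 138–139)] -/
theorem klainerman_szeftel_kerr_stability_small_a_layer_cones.mono_order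
    (h : klainerman_szeftel_kerr_stability_small_a_layer_cones) {k' k'' : ℕ} (hk : k'' ≤ k') :
    ∃ (k : ℕ) (p δ : ℝ), ∃ θ > (0 : ℝ), ∃ a₀ > (0 : ℝ),
      ∀ (M a : ℝ), 0 < M → |a| < a₀ * M → ∀ η > (0 : ℝ), ∃ ε > (0 : ℝ),
        ∀ (X : Type) [TopologicalSpace X] [ChartedSpace E3 X] [IsManifold (𝓡 3) ∞ X]
          [ConnectedSpace X] (D : InitialDataSet (𝓡 3) X) [D.metric.HasLeviCivita],
        D.IsVacuumConstraintSolution →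
          ∀ 𝒟 : VacuumCauchyDevelopment D, 𝒟.IsMaximal →
            ∀ (τ : ℝ) (c : 𝒟.toCauchyDevelopment.KerrLayerChart M a τ (θ * M)),
              c.layerNorm k p δ ≤ ENNReal.ofReal ε →
                ∃ (M' a' : ℝ) (𝒟oc : Set 𝒟.carrier), Kerr.IsSubextremal M' a' ∧
                  |M' - M| + |a' - a| ≤ η ∧
                  𝒟oc ⊆ 𝒟.metric.causalFuture 𝒟.timeOrientation (range c.toFun) ∧
                  c.HasCompleteFutureNullInfinityFar ∧
                  𝒟.toSpacetime.ConvergesToKerrAlongCones 𝒟oc M' a' τ (θ * M) k' ∧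
                  𝒟.toSpacetime.ConvergesToKerrAlongCones 𝒟oc M' a' τ (θ * M) k'' := by
  obtain ⟨k, p, δ, θ, hθ, a₀, ha₀, H⟩ := h k'
  refine ⟨k, p, δ, θ, hθ, a₀, ha₀, fun M a hM ha η hη ↦ ?_⟩
  obtain ⟨ε, hε, Hε⟩ := H M a hM ha η hη
  refine ⟨ε, hε, fun X _ _ _ _ D _ hD 𝒟 h𝒟 τ c hc ↦ ?_⟩
  obtain ⟨M', a', 𝒟oc, hsub, hpar, hJ, hnull, hconv⟩ := Hε X D hD 𝒟 h𝒟 τ c hc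
  exact ⟨M', a', 𝒟oc, hsub, hpar, hJ, hnull, hconv, hconv.of_le hk⟩

end Literature.Geometry.Lorentzian
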